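import Summits.ValiantsHypothesis.ValiantsHypothesis.Theses.DivisionGap
import Summits.ValiantsHypothesis.ValiantsHypothesis.Theorems.DivisionGapDefs
import Summits.ValiantsHypothesis.ValiantsHypothesis.Theorems.DivisionGapPerDivisionHardSparseFibre
import Summits.ValiantsHypothesis.ValiantsHypothesis.Theorems.DivisionGapPerDivisionHardStubDecidedAtoms
import Summits.ValiantsHypothesis.ValiantsHypothesis.Theorems.DivisionGapPerDivisionHardStubAtomicTorus
import Summits.ValiantsHypothesis.ValiantsHypothesis.Theorems.DivisionGapPerDivisionHardStubAtomicTop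

/-!
# Crux `DivisionGap.PerDivisionHard` (stmt-ValiantsHypothesis-5065) — the FREE ATOMIC RUNG

`PerDivisionHard` asks, for every `c` and all large `n`, that every nonzero cofactor
`h ∈ ℝ≥0[x_ij]` satisfies `2^{(log₂ n + c)^c} < L(per_n · h) + L(h)`.  This file proves it for every
ATOMIC EXPRESSION `h = Σ_{l ∈ L} a_l · x^{C_l} · ∏_{β ∈ I} F_β^{μ_l(β)}` — finitely many terms, each a
monomial times a product of powers of shared atoms `F_β` (arbitrary nonzero polynomials) — with at
most `2^{(log₂ n + c)^c}` terms and `Σ_β |supp F_β|² ≤ 2^{⌊√n⌋/(log₂ n + e)^e}` (`e` absolute), of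
arbitrary degrees, multiplicities and cost, and — unlike the atomic rung
`Theorems/DivisionGapPerDivisionHardAtomic.lean` — with NO hypothesis on the pairwise atomic
distance of the terms:

* `perDivisionHard_atomicFree`.

It is the composition `perDivisionHard_atomicFree_of` of skeleton v8 of line
`pair-descent-jss-endpoint` (`Cruxes/PerDivisionHard/Lines/pair_descent_jss_endpoint.lean`) with
every stub a landed theorem: torus normal form of an atomic expression (`stub_atomicTorus`) → a
LARGE placed block `G(b,k) ⊕ M₀` (`n ≤ b⁴`) and a generic cut deciding every atom
(`stub_decidedAtoms`) → by `stub_atomicTop` every fibre monomial is `C_l + Σ_β μ_l(β) · t_β` for the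
unique atom tops `t_β`, so the fibre has at most `|L|` monomials → the sparse-fibre rung
`perDivisionHard_sparseFibre` (descent across scales: the projected pair at size `b` is handled by
the sparse rung).  Covers e.g. every sum of `≤ 2^{(log₂ n + c)^c}` products of `2 × 2` permanents /
binomials over arbitrary (e.g. pairwise disjoint) tilings — the `r ≥ 3` case left open by the
pair-flip rung `Theorems/DivisionGapPerDivisionHardPairBinomial.lean`.
-/

noncomputable section

-- `Summit.ValiantsHypothesis.ValiantsHypothesis.…` is the tree's mandated single-conjunct layout
-- (Sub = Summit), so the duplicated namespace component is intended.
set_option linter.dupNamespace false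

namespace Summit.ValiantsHypothesis.ValiantsHypothesis.Theorems.DivisionGapPerDivisionHard

open MvPolynomial Literature.Computability.AlgebraicComplexity
open Summit.ValiantsHypothesis.ValiantsHypothesis.Theorems.ZeroOneTransfer.Negative (topComponent)
open scoped NNReal

/-- **The free atomic rung of `PerDivisionHard`.**  For every `c` there are `e, n₀` such that for
all `n ≥ n₀` and every atomic expression `Σ_{l ∈ L} a_l · x^{C_l} · ∏_{β ∈ I} F_β^{μ_l(β)}` with
nonzero atoms, nonzero value, at most `2^{(log₂ n + c)^c}` terms and
`Σ_β |supp F_β|² ≤ 2^{⌊√n⌋/(log₂ n + e)^e}`, the pair inequality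
`2^{(log₂ n + c)^c} < L(per_n · h) + L(h)` holds — any degrees, multiplicities, cost, and no
pairwise-distance hypothesis.  Composition of the landed stubs of line `pair-descent-jss-endpoint`
(seat c4, descent across scales). [folklore] -/
theorem perDivisionHard_atomicFree :
    ∀ c : ℕ, ∃ e n₀ : ℕ, ∀ n ≥ n₀, ∀ (ι κ : Type) (I : Finset ι) (L : Finset κ)
      (F : ι → MvPolynomial (Fin n × Fin n) ℝ≥0) (a : κ → ℝ≥0) (C : κ → (Fin n × Fin n) →₀ ℕ)
      (μ : κ → ι → ℕ),
      (∀ β ∈ I, F β ≠ 0) →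
      (∑ l ∈ L, a l • (monomial (C l) (1 : ℝ≥0) * ∏ β ∈ I, F β ^ μ l β)) ≠ 0 →
      L.card ≤ 2 ^ ((Nat.log 2 n + c) ^ c) →
      (∑ β ∈ I, (F β).support.card ^ 2) ≤ 2 ^ (Nat.sqrt n / (Nat.log 2 n + e) ^ e) →
      2 ^ ((Nat.log 2 n + c) ^ c) <
        complexity (perPoly (Fin n) ℝ≥0 *
            ∑ l ∈ L, a l • (monomial (C l) (1 : ℝ≥0) * ∏ β ∈ I, F β ^ μ l β)) +
          complexity (∑ l ∈ L, a l • (monomial (C l) (1 : ℝ≥0) * ∏ β ∈ I, F β ^ μ l β)) := by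
  classical
  intro c
  obtain ⟨e, n₁, hD⟩ := stub_decidedAtoms
  obtain ⟨n₂, hR⟩ := perDivisionHard_sparseFibre 4 c
  refine ⟨e, n₁ + n₂, ?_⟩
  intro n hn ι κ I L F a C μ hF hh hL hI
  obtain ⟨L', F', hL'L, -, hF'tor, hF'supp, hh', -, hle1, hle2⟩ :=
    stub_atomicTorus n ι κ I L F a C μ hF hh
  have hI' : (∑ β ∈ I, (F' β).support.card ^ 2) ≤ 2 ^ (Nat.sqrt n / (Nat.log 2 n + e) ^ e) :=
    le_trans (Finset.sum_le_sum fun β hβ =>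
      Nat.pow_le_pow_left (Finset.card_le_card (hF'supp β hβ)) 2) hI
  obtain ⟨b, k, m, eR, eC, w, hnb, hcut, hdec⟩ := hD n (by omega) ι I F' hF'tor hI'
  set h' := ∑ l ∈ L', a l • (monomial (C l) (1 : ℝ≥0) * ∏ β ∈ I, F' β ^ μ l β) with hh'def
  -- a representative of each (at most one-element) atom fibre
  have ht' : ∀ β, ∃ tβ : (Fin n × Fin n) →₀ ℕ,
      β ∈ I → ∀ f ∈ (topComponent w (F' β)).support, f = tβ := by
    intro β
    by_cases hne : (topComponent w (F' β)).support.Nonempty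
    · obtain ⟨f₀, hf₀⟩ := hne
      exact ⟨f₀, fun hβ f hf => hdec β hβ f hf f₀ hf₀⟩
    · exact ⟨0, fun _ f hf => absurd ⟨f, hf⟩ hne⟩
  choose t ht using ht'
  -- every fibre monomial of `h'` is `C_l + Σ_β μ_l β • t_β` for some `l ∈ L'`
  have hsub : (topComponent w h').support ⊆
      L'.image fun l => C l + ∑ β ∈ I, μ l β • t β := by
    intro m₀ hm₀
    obtain ⟨l, hl, f, hf, hm₀eq⟩ := stub_atomicTop n ι κ I L' F' a C μ w m₀ hm₀
    refine Finset.mem_image.mpr ⟨l, hl, ?_⟩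
    rw [hm₀eq]
    congr 1
    refine Finset.sum_congr rfl fun β hβ => ?_
    rw [Finset.sum_congr rfl fun j hj => ht β hβ _ (hf β hβ j (Finset.mem_range.mp hj)),
      Finset.sum_const, Finset.card_range]
  have hfib : (topComponent w h').support.card ≤ 2 ^ ((Nat.log 2 n + c) ^ c) :=
    calc (topComponent w h').support.card
        ≤ (L'.image fun l => C l + ∑ β ∈ I, μ l β • t β).card := Finset.card_le_card hsub
      _ ≤ L'.card := Finset.card_image_le
      _ ≤ L.card := Finset.card_le_card hL'L
      _ ≤ 2 ^ ((Nat.log 2 n + c) ^ c) := hL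
  have hmain := hR n (by omega) h' hh' ⟨b, k, m, eR, eC, w, hcut, hnb, hfib⟩
  exact lt_of_lt_of_le hmain (Nat.add_le_add hle1 hle2)

end Summit.ValiantsHypothesis.ValiantsHypothesis.Theorems.DivisionGapPerDivisionHard

end
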